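import Mathlib
import Literature.AlgebraicGeometry.Tropical.TorusCycles
import Summits.HodgeConjecture.HodgeConjecture.Theorems.TropicalWeilObstructionTropicalWeilVanishingFlatObstructionLinAlg
import Summits.HodgeConjecture.HodgeConjecture.Theorems.TropicalWeilObstructionTropicalWeilVanishingNoLift
import HarnessLib

/-!
# Flat effective tropical `4`-cycles with non-zero Weil functional are obstructed at the identity
# — the registered stub `stub_rung_flatObstructed` of crux `TropicalWeilVanishing`
# (stmt-HodgeConjecture-18478, line `identity_transfer`), unfolded

Route `TropicalWeilObstruction` of `HodgeConjecture`. The skeleton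
`Cruxes/TropicalWeilVanishing/Lines/identity_transfer.lean` registers
`stub_rung_flatObstructed : ∀ Z₀ : TropicalTorusCycle 8 4 1, weilFunctional Z₀ ≠ 0 → IsFlat Z₀ →
ObstructedAtIdentity Z₀` with skeleton-local predicates `IsFlat`, `SameType`, `ObstructedAtIdentity`
(not importable from `Theorems/`); `flatObstructed_of_weilFunctional_ne_zero` below is that statement
with the three predicates unfolded verbatim, so the skeleton closes by
`fun Z₀ hW hflat => flatObstructed_of_weilFunctional_ne_zero Z₀ hW hflat`.

Proof (purely algebraic, no topology of the torus):
* (this file, Part B) `vertex_sub_vertex_sub_mulVec_mem`, `mulVec_cycleSum_mem` — if all frames of an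
  effective tropical cycle over `Q'` have columns in a subspace `M`, then for every real INCIDENCE
  CYCLE `y` (weights on pairs of facet slots in a common class with zero net weight at each cell)
  `Q' · Σ_e y_e (k_{σ₁e} - k_{σ₂e}) ∈ M` (both facets of a pair are `Q'`-translates of one reference
  simplex, and vertices of a cell differ by frame combinations);
* (this file, Part C) `exists_cycle_weights` — an effective cycle with a cell carries an incidence cycle
  with non-zero total shift `κ`: otherwise every coordinate of the shift cochain is a coboundary
  (finite-dimensional duality, `Submodule.exists_dual_map_eq_bot_of_notMem`), i.e. real potentials
  exist, contradicting `no_potentials` (file `…NoLift`, discrete Stokes);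
* (file `…FlatObstructionLinAlg`) `exists_obstruction_of_constraint` — with `η(L) ≠ 0` (from
  `W(Z₀) ≠ 0`) and `κ ∈ M = L·ℝ⁴` (the cycle `Z₀` realises its own type at `Q' = 1`), a functional
  killing `{Q' | Q' κ ∈ M}` — which contains every period where the type of `Z₀` realises, by Part B
  applied to the realisation — and non-zero on a symmetric `J`-commuting matrix.

Mathlib + tree lemmas only; no definition, no named fact, no sorry.
-/

-- `Summit.HodgeConjecture.HodgeConjecture.…` is the mandated namespace (single-conjunct summit).
set_option linter.dupNamespace false

noncomputable section

open scoped BigOperators Matrix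
open Matrix Literature.AlgebraicGeometry.Tropical

namespace Summit.HodgeConjecture.HodgeConjecture.Theorems.TropicalWeilVanishing

variable {g q : ℕ} {Q : Matrix (Fin g) (Fin g) ℝ}

/-! ## Part B — weighted incidence cycles force `Q κ ∈ M` on every flat realisation -/

/-- **One facet class, two slots.** If the facet slots `(σ,i)` and `(τ,j)` of an effective tropical
cycle lie in the same class, and all frames have columns in a subspace `M`, then
`v_{σ,0} - v_{τ,0} - Q (k_{σ,i} - k_{τ,j}) ∈ M` (both facets are `Q`-translates of the same reference
simplex, and every vertex of a cell differs from its vertex `0` by a frame combination).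
[cite: MikhalkinZharkov2014Eigenwave, Def. 4.2] -/
theorem vertex_sub_vertex_sub_mulVec_mem (Z : TropicalTorusCycle g (q + 1) Q)
    (M : Submodule ℝ (Fin g → ℝ))
    (hflat : ∀ (σ : Fin Z.numCells) (m : Fin (q + 1)), (fun a => ((Z.cell σ).frame a m : ℝ)) ∈ M)
    {σ τ : Fin Z.numCells} {i j : Fin (q + 2)} (hcls : Z.facetClass σ i = Z.facetClass τ j) :
    (Z.cell σ).vertex 0 - (Z.cell τ).vertex 0 -
      Q *ᵥ ((fun a => (Z.facetShift σ i a : ℝ)) - fun a => (Z.facetShift τ j a : ℝ)) ∈ M := by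
  -- every vertex of a cell is its vertex `0` plus a frame combination
  have hv : ∀ (ρ : Fin Z.numCells) (k : Fin (q + 2)), (Z.cell ρ).vertex k - (Z.cell ρ).vertex 0 ∈ M := by
    intro ρ k
    refine Fin.cases ?_ (fun k' => ?_) k
    · simp
    · have : (Z.cell ρ).vertex k'.succ - (Z.cell ρ).vertex 0 =
          ∑ m, (Z.cell ρ).edgeCoeff m k' • fun a => ((Z.cell ρ).frame a m : ℝ) := by
        ext a
        simp only [Pi.sub_apply, Finset.sum_apply, Pi.smul_apply, smul_eq_mul]
        rw [(Z.cell ρ).vertex_succ_sub k' a]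
        exact Finset.sum_congr rfl fun m _ => mul_comm _ _
      rw [this]
      exact M.sum_mem fun m _ => M.smul_mem _ (hflat ρ m)
  -- the chosen vertex of each facet is `R_f 0 + Q k`
  have hu : ∀ (ρ : Fin Z.numCells) (k : Fin (q + 2)),
      (Z.cell ρ).vertex (k.succAbove (Z.facetPerm ρ k 0)) =
        Z.refFacet (Z.facetClass ρ k) 0 + Q *ᵥ fun a => (Z.facetShift ρ k a : ℝ) := by
    intro ρ k
    ext a
    rw [Pi.add_apply, Z.facet_eq ρ k 0 a]
    rfl
  have h1 := hv σ (i.succAbove (Z.facetPerm σ i 0))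
  have h2 := hv τ (j.succAbove (Z.facetPerm τ j 0))
  rw [hu] at h1 h2
  rw [hcls] at h1
  have := M.sub_mem h2 h1
  rw [Matrix.mulVec_sub]
  convert this using 1
  abel

/-- **Weighted incidence cycles.** For an effective tropical cycle all of whose frames have columns
in `M`, any real weights `y` on pairs of facet slots in a common class which form a CYCLE (zero net
weight at every cell: `Σ_e y_e (φ(σ₁ e) - φ(σ₂ e)) = 0` for all `φ`) satisfy
`Q · Σ_e y_e (k_{σ₁ e} - k_{σ₂ e}) ∈ M`. [cite: MikhalkinZharkov2014Eigenwave, Def. 4.2] -/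
theorem mulVec_cycleSum_mem (Z : TropicalTorusCycle g (q + 1) Q) (M : Submodule ℝ (Fin g → ℝ))
    (hflat : ∀ (σ : Fin Z.numCells) (m : Fin (q + 1)), (fun a => ((Z.cell σ).frame a m : ℝ)) ∈ M)
    {P : Type*} [Fintype P] (s₁ s₂ : P → Fin Z.numCells) (i₁ i₂ : P → Fin (q + 2))
    (hcls : ∀ e, Z.facetClass (s₁ e) (i₁ e) = Z.facetClass (s₂ e) (i₂ e)) (y : P → ℝ)
    (hcyc : ∀ φ : Fin Z.numCells → ℝ, ∑ e, y e * (φ (s₁ e) - φ (s₂ e)) = 0) :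
    Q *ᵥ (∑ e, y e • ((fun a => (Z.facetShift (s₁ e) (i₁ e) a : ℝ)) -
      fun a => (Z.facetShift (s₂ e) (i₂ e) a : ℝ))) ∈ M := by
  have hsum : ∑ e, y e • ((Z.cell (s₁ e)).vertex 0 - (Z.cell (s₂ e)).vertex 0 -
      Q *ᵥ ((fun a => (Z.facetShift (s₁ e) (i₁ e) a : ℝ)) - fun a => (Z.facetShift (s₂ e) (i₂ e) a : ℝ))) ∈ M :=
    M.sum_mem fun e _ => M.smul_mem _ (vertex_sub_vertex_sub_mulVec_mem Z M hflat (hcls e))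
  have hv0 : ∑ e, y e • ((Z.cell (s₁ e)).vertex 0 - (Z.cell (s₂ e)).vertex 0) = 0 := by
    ext a
    simp only [Finset.sum_apply, Pi.smul_apply, Pi.sub_apply, smul_eq_mul, Pi.zero_apply]
    exact hcyc fun ρ => (Z.cell ρ).vertex 0 a
  have hsplit : ∑ e, y e • ((Z.cell (s₁ e)).vertex 0 - (Z.cell (s₂ e)).vertex 0 -
      Q *ᵥ ((fun a => (Z.facetShift (s₁ e) (i₁ e) a : ℝ)) - fun a => (Z.facetShift (s₂ e) (i₂ e) a : ℝ))) =
      ∑ e, y e • ((Z.cell (s₁ e)).vertex 0 - (Z.cell (s₂ e)).vertex 0) -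
      ∑ e, y e • (Q *ᵥ ((fun a => (Z.facetShift (s₁ e) (i₁ e) a : ℝ)) -
        fun a => (Z.facetShift (s₂ e) (i₂ e) a : ℝ))) := by
    rw [← Finset.sum_sub_distrib]
    exact Finset.sum_congr rfl fun e _ => smul_sub _ _ _
  have hQ : ∑ e, y e • (Q *ᵥ ((fun a => (Z.facetShift (s₁ e) (i₁ e) a : ℝ)) -
        fun a => (Z.facetShift (s₂ e) (i₂ e) a : ℝ))) =
      Q *ᵥ (∑ e, y e • ((fun a => (Z.facetShift (s₁ e) (i₁ e) a : ℝ)) -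
        fun a => (Z.facetShift (s₂ e) (i₂ e) a : ℝ))) := by
    rw [Matrix.mulVec_sum]
    exact Finset.sum_congr rfl fun e _ => (Matrix.mulVec_smul _ _ _).symm
  rw [hsplit, hv0, zero_sub, hQ] at hsum
  exact (M.neg_mem_iff).1 hsum

/-! ## Part C — duality: an effective cycle with a cell carries an incidence cycle of non-zero shift -/

/-- **Non-trivial incidence cycle.** An effective tropical cycle with at least one cell carries real
weights `y` on the pairs of facet slots in a common class, forming a cycle (zero net weight at every
cell), whose total shift `κ = Σ_e y_e (k_{σ₁ e} - k_{σ₂ e})` is non-zero. (If every coordinate of the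
shift cochain were a coboundary there would be potentials, contradicting `no_potentials`; a
coordinate outside the range of the coboundary map is separated from it by a functional — the
weights.) [cite: MikhalkinZharkov2014Eigenwave, Def. 4.2] -/
theorem exists_cycle_weights (Z : TropicalTorusCycle g (q + 1) Q) (h0 : 0 < Z.numCells) :
    ∃ y : {e : (Fin Z.numCells × Fin (q + 2)) × (Fin Z.numCells × Fin (q + 2)) //
        Z.facetClass e.1.1 e.1.2 = Z.facetClass e.2.1 e.2.2} → ℝ,
      (∀ φ : Fin Z.numCells → ℝ, ∑ e, y e * (φ e.1.1.1 - φ e.1.2.1) = 0) ∧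
      ∑ e, y e • ((fun a => (Z.facetShift e.1.1.1 e.1.1.2 a : ℝ)) -
        fun a => (Z.facetShift e.1.2.1 e.1.2.2 a : ℝ)) ≠ 0 := by
  classical
  set P := {e : (Fin Z.numCells × Fin (q + 2)) × (Fin Z.numCells × Fin (q + 2)) //
    Z.facetClass e.1.1 e.1.2 = Z.facetClass e.2.1 e.2.2} with hP
  -- the coboundary map and the shift cochain, coordinate by coordinate
  let A₀ : (Fin Z.numCells → ℝ) →ₗ[ℝ] (P → ℝ) :=
    { toFun := fun φ e => φ e.1.1.1 - φ e.1.2.1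
      map_add' := fun φ ψ => by ext e; simp only [Pi.add_apply]; ring
      map_smul' := fun c φ => by ext e; simp only [Pi.smul_apply, smul_eq_mul, RingHom.id_apply]; ring }
  let d : Fin g → P → ℝ := fun a e => (Z.facetShift e.1.1.1 e.1.1.2 a : ℝ) - (Z.facetShift e.1.2.1 e.1.2.2 a : ℝ)
  by_cases hall : ∀ a, d a ∈ LinearMap.range A₀
  · exfalso
    choose φ hφ using hall
    refine no_potentials Z h0 (fun σ a => φ a σ) fun σ i τ j hcls => ?_
    ext a
    have := congrFun (hφ a) ⟨((σ, i), (τ, j)), hcls⟩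
    simpa [A₀, d] using this.symm
  · push Not at hall
    obtain ⟨a, ha⟩ := hall
    obtain ⟨ℓ, hℓd, hℓA⟩ := Submodule.exists_dual_map_eq_bot_of_notMem ha inferInstance
    have hsingle : ∀ e : P, (fun j => if e = j then (1 : ℝ) else 0) = Pi.single e 1 := fun e => by
      ext j; simp [Pi.single_apply, eq_comm]
    refine ⟨fun e => ℓ (Pi.single e 1), fun φ => ?_, fun hzero => ?_⟩
    · have h1 : ℓ (A₀ φ) = 0 := by
        have : ℓ (A₀ φ) ∈ (LinearMap.range A₀).map ℓ := Submodule.mem_map_of_mem ⟨φ, rfl⟩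
        rw [hℓA] at this
        simpa using this
      rw [LinearMap.pi_apply_eq_sum_univ ℓ (A₀ φ)] at h1
      simp only [hsingle] at h1
      refine Eq.trans (Finset.sum_congr rfl fun e _ => ?_) h1
      simp only [A₀, LinearMap.coe_mk, AddHom.coe_mk, smul_eq_mul]
      ring
    · apply hℓd
      have h2 := congrFun hzero a
      simp only [Finset.sum_apply, Pi.smul_apply, Pi.sub_apply, smul_eq_mul, Pi.zero_apply] at h2
      rw [LinearMap.pi_apply_eq_sum_univ ℓ (d a)]
      simp only [hsingle]
      refine Eq.trans (Finset.sum_congr rfl fun e _ => ?_) h2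
      simp only [d, smul_eq_mul]
      ring

/-! ## Assembly — the registered stub `stub_rung_flatObstructed`, unfolded -/

/-- **Flat effective tropical `4`-cycles with non-zero Weil functional are obstructed at the
identity** — the registered stub `stub_rung_flatObstructed` of `Cruxes/TropicalWeilVanishing/Lines/identity_transfer.lean`
with the skeleton-local predicates `IsFlat`, `SameType`, `ObstructedAtIdentity` unfolded verbatim.
Proof: `W(Z₀) ≠ 0` gives a cell with `η(L) ≠ 0` (so `M = L·ℝ⁴` is totally real) and flatness puts every
frame in `M`; `exists_cycle_weights` gives an incidence cycle `y` of `Z₀`'s type with total shift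
`κ ≠ 0`; `mulVec_cycleSum_mem` at `Q' = 1` (the cycle `Z₀` itself) puts `κ ∈ M`, and at any realisation
`Z'` of the same type over `Q'` (same frames, classes, shifts) puts `Q' κ ∈ M`; so the functional of
`exists_obstruction_of_constraint` kills every realisable `Q'` and not all of `Sym_J`.
[cite: Zharkov2020TropicalWeil, §1–2 (pp. 2–4)] [cite: MikhalkinZharkov2014Eigenwave, Def. 4.2 and Prop. 4.3] -/
theorem flatObstructed_of_weilFunctional_ne_zero
    (Z₀ : TropicalTorusCycle (2 * 4) 4 (1 : Matrix (Fin (2 * 4)) (Fin (2 * 4)) ℝ))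
    (hW : weilFunctional Z₀ ≠ 0)
    (hflat : ∀ σ σ' : Fin Z₀.numCells, ∀ m : Fin 4, ∃ c : Fin 4 → ℝ,
      ∀ a : Fin (2 * 4), ((Z₀.cell σ).frame a m : ℝ) = ∑ m' : Fin 4, ((Z₀.cell σ').frame a m' : ℝ) * c m') :
    ∃ ℓ : Matrix (Fin (2 * 4)) (Fin (2 * 4)) ℝ →ₗ[ℝ] ℝ,
      (∃ D : Matrix (Fin (2 * 4)) (Fin (2 * 4)) ℝ, D.IsSymm ∧
        D * weilJ 4 = weilJ 4 * D ∧ ℓ D ≠ 0) ∧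
      ∀ Q' : Matrix (Fin (2 * 4)) (Fin (2 * 4)) ℝ, Q'.IsSymm → Q' * weilJ 4 = weilJ 4 * Q' →
        (∃ Z' : TropicalTorusCycle (2 * 4) 4 Q',
          ∃ (hc : Z'.numCells = Z₀.numCells) (hf : Z'.numFacetClasses = Z₀.numFacetClasses),
            ∀ σ : Fin Z'.numCells,
              (Z'.cell σ).weight = (Z₀.cell (Fin.cast hc σ)).weight ∧
              (Z'.cell σ).frame = (Z₀.cell (Fin.cast hc σ)).frame ∧
              ∀ i : Fin (4 + 1),
                Fin.cast hf (Z'.facetClass σ i) = Z₀.facetClass (Fin.cast hc σ) i ∧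
                Z'.facetPerm σ i = Z₀.facetPerm (Fin.cast hc σ) i ∧
                Z'.facetShift σ i = Z₀.facetShift (Fin.cast hc σ) i) → ℓ Q' = 0 := by
  classical
  -- (1) a cell whose frame has `η ≠ 0`; in particular there is a cell
  have hW' : ∑ σ, ((Z₀.cell σ).weight : ℂ) * ((Z₀.cell σ).latticeVolume : ℂ) *
      frameComplexDet 4 (Z₀.cell σ).frame ^ 2 ≠ 0 := hW
  obtain ⟨σ₁, -, hσ₁⟩ := Finset.exists_ne_zero_of_sum_ne_zero hW'
  have hη : frameComplexDet 4 (Z₀.cell σ₁).frame ≠ 0 := by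
    intro h; apply hσ₁; rw [h]; simp
  have h0 : 0 < Z₀.numCells := Fin.pos σ₁
  set L : Matrix (Fin (2 * 4)) (Fin 4) ℤ := (Z₀.cell σ₁).frame with hL
  set M : Submodule ℝ (Fin (2 * 4) → ℝ) := LinearMap.range (L.map ((↑) : ℤ → ℝ)).mulVecLin with hM
  -- (2) flatness: every frame column lies in `M`
  have hflatM : ∀ (σ : Fin Z₀.numCells) (m : Fin 4), (fun a => ((Z₀.cell σ).frame a m : ℝ)) ∈ M := by
    intro σ m
    obtain ⟨c, hc⟩ := hflat σ σ₁ m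
    refine ⟨c, ?_⟩
    ext a
    simp only [Matrix.mulVecLin_apply, Matrix.mulVec, dotProduct, Matrix.map_apply]
    rw [hc a]
  -- (3) an incidence cycle of `Z₀`'s type with non-zero total shift `κ`
  obtain ⟨y, hcyc, hκ⟩ := exists_cycle_weights Z₀ h0
  -- (4) `κ ∈ M`: `Z₀` realises its own type at `Q' = 1`
  have hκM := mulVec_cycleSum_mem Z₀ M hflatM (fun e => e.1.1.1) (fun e => e.1.2.1)
    (fun e => e.1.1.2) (fun e => e.1.2.2) (fun e => e.2) y hcyc
  rw [Matrix.one_mulVec] at hκM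
  -- (5) the obstruction functional
  obtain ⟨ℓ, hD, hvan⟩ := exists_obstruction_of_constraint (n := 4) (by norm_num) L hη _ hκM hκ
  refine ⟨ℓ, hD, fun Q' _ _ hZ' => hvan Q' ?_⟩
  obtain ⟨Z', hc, hf, hZ'⟩ := hZ'
  -- (6) `Z'` is flat w.r.t. `M` and carries the same incidence cycle, so `Q' κ ∈ M`
  have hcast : ∀ σ : Fin Z₀.numCells, Fin.cast hc (Fin.cast hc.symm σ) = σ := fun σ => Fin.ext rfl
  have hflat' : ∀ (σ : Fin Z'.numCells) (m : Fin 4), (fun a => ((Z'.cell σ).frame a m : ℝ)) ∈ M := by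
    intro σ m
    rw [(hZ' σ).2.1]
    exact hflatM _ m
  have hcls' : ∀ e : {e : (Fin Z₀.numCells × Fin (3 + 2)) × (Fin Z₀.numCells × Fin (3 + 2)) //
      Z₀.facetClass e.1.1 e.1.2 = Z₀.facetClass e.2.1 e.2.2},
      Z'.facetClass (Fin.cast hc.symm e.1.1.1) e.1.1.2 = Z'.facetClass (Fin.cast hc.symm e.1.2.1) e.1.2.2 := by
    intro e
    apply Fin.cast_injective hf
    rw [((hZ' _).2.2 _).1, ((hZ' _).2.2 _).1, hcast, hcast]
    exact e.2
  have hcyc' : ∀ φ : Fin Z'.numCells → ℝ,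
      ∑ e, y e * (φ (Fin.cast hc.symm e.1.1.1) - φ (Fin.cast hc.symm e.1.2.1)) = 0 :=
    fun φ => hcyc fun σ => φ (Fin.cast hc.symm σ)
  have key := mulVec_cycleSum_mem Z' M hflat' (fun e => Fin.cast hc.symm e.1.1.1)
    (fun e => Fin.cast hc.symm e.1.2.1) (fun e => e.1.1.2) (fun e => e.1.2.2) hcls' y hcyc'
  have hshift : ∀ e : {e : (Fin Z₀.numCells × Fin (3 + 2)) × (Fin Z₀.numCells × Fin (3 + 2)) //
      Z₀.facetClass e.1.1 e.1.2 = Z₀.facetClass e.2.1 e.2.2},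
      ((fun a => (Z'.facetShift (Fin.cast hc.symm e.1.1.1) e.1.1.2 a : ℝ)) -
        fun a => (Z'.facetShift (Fin.cast hc.symm e.1.2.1) e.1.2.2 a : ℝ)) =
      ((fun a => (Z₀.facetShift e.1.1.1 e.1.1.2 a : ℝ)) -
        fun a => (Z₀.facetShift e.1.2.1 e.1.2.2 a : ℝ)) := by
    intro e
    rw [((hZ' _).2.2 _).2.2, ((hZ' _).2.2 _).2.2, hcast, hcast]
  simp only [hshift] at key
  exact key

end Summit.HodgeConjecture.HodgeConjecture.Theorems.TropicalWeilVanishing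

end
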